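import Literature.MathematicalPhysics.QuantumManyBody.StateRelaxationDuality
import Literature.MathematicalPhysics.QuantumLattice.FreeFermiGasNoPairFieldLRO
import HarnessLib

/-!
# Ground-state (state-optimality, "KKT") Gram blocks for state relaxations

Topic `Literature/MathematicalPhysics/QuantumManyBody`; namespace
`Literature.MathematicalPhysics.QuantumManyBody.StateRelaxation` (as `StateRelaxationDuality`, whose
`gramForm` this file parallels). Everything here is PROVED; no named fact is introduced.

A moment ("bootstrap") relaxation of a GROUND-STATE problem may impose, besides positivity
`ω(a⋆a) ≥ 0` and the eigenstate equations `ω(h p - p h) = 0`, the second-order STATE-OPTIMALITY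
condition of Araújo–Klep–Garner–Vértesi–Navascués (§3.2, Prop. 11, eq. (state optimality)):
`ω(p⋆ h p - ½{h, p⋆p}) ≥ 0` for all `p` — for an eigenstate of `h` equivalently
`ω(p⋆ (h p - p h)) ≥ 0`, i.e. the ground-state inequality `⟨pψ, (H - E₀) pψ⟩ ≥ 0`
(Bratteli–Robinson II, Prop. 5.3.19; Fawzi–Fawzi–Scalet 2024, §2). In an SDP it is the PSD block
`[ω(B_a⋆ (h B_b - B_b h))]_{ab} ⪰ 0` over a finite generator family `B`; in a rounded DUAL
certificate it appears as the element

  `kktForm h G B = Σ_ab G_ab • (B_a⋆ (h B_b - B_b h))`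

with a positive semidefinite multiplier `G`, and its expectation is nonnegative in every state that
satisfies the ground-state inequality on the linear span of the `B_b` (`re_map_kktForm_nonneg`:
factor `G = L⋆ L`, then `ω(kktForm h G B) = Σ_k ω(C_k⋆ (h C_k - C_k h))` with `C_k = Σ_b L_kb B_b`,
`map_kktForm_of_eq_star_mul`).

Finite-dimensional instance (the form consumed by certificate ROWS on finite tori): for a Hermitian
matrix `A`, a sector `K ≤ ℂⁿ`, a sector ground state `ψ ∈ K`, `A ψ = E_K ψ` (`E_K = minEnergyOn A K`)
and generators PRESERVING the sector (`B_b w ∈ K` for `w ∈ K`): `0 ≤ Re ⟨ψ, kktForm A G B ψ⟩`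
(`re_vectorState_kktForm_nonneg_of_sectorGS`; the one-generator inequality is the sector form of
Bratteli–Robinson II Prop. 5.3.19, cf. `star_dotProduct_conjTranspose_mul_commutator_mulVec_nonneg`
in `InfVolFermionStateTorusLimitLocalStability`, re-derived here to keep this file's imports light).
On fermionic Fock spaces a generator
commuting with `N̂` and `S^z` preserves every joint sector (`mulVec_mem_szSector_of_commute`);
generators CHANGING the charge are NOT covered (the inequality then involves the other sector's
energy). Remark (not formalised): with the energy `h` itself as objective these blocks are implied by
optimality of the relaxation (AKS Prop. 11) and cannot move the bound; with another objective (an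
observable in an energy window) they are genuine constraints.

## References
* M. Araújo, I. Klep, A. J. P. Garner, T. Vértesi, M. Navascués, *First-order optimality conditions
  for non-commutative optimization problems*, arXiv:2311.18707, §3.2 Prop. 11.
  [cite: AraujoEtAl2023, §3.2 Prop. 11]
* H. Fawzi, O. Fawzi, S. O. Scalet, *Certified algorithms for equilibrium states of local quantum
  Hamiltonians*, Nat. Commun. 15 (2024) 7394, §2. [cite: FawziFawziScalet2024, §2]
* O. Bratteli, D. W. Robinson, *Operator Algebras and Quantum Statistical Mechanics 2*, 2nd ed.
  (1997), Prop. 5.3.19. [cite: BratteliRobinsonII1997, Prop. 5.3.19]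
* M. G. Scheer, N. Chadha, D.-C. Lu, E. Khalaf, *Defect Bootstrap: Tight Ground State Bounds in
  Spontaneous Symmetry Breaking Phases*, arXiv:2511.20860, §II eq. (2) ("perturbative positivity"
  `tr(O†[H,O]ρ) ≥ 0` for `O ∈ Span(P)` as a constraint of OBSERVABLE bounds `⟨R⟩_min/max`).
  [cite: ScheerEtAl2025, §II eq. (2)]
-/

noncomputable section

open Matrix Finset
open scoped ComplexOrder MatrixOrder BigOperators

namespace Literature.MathematicalPhysics.QuantumManyBody.StateRelaxation

/-! ### Abstract `⋆`-algebra: the KKT element and its nonnegativity under a PSD multiplier -/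

section Abstract

variable {𝓐 : Type*} [Ring 𝓐] [StarRing 𝓐] [Algebra ℂ 𝓐] [StarModule ℂ 𝓐]
variable {m : Type*} [Fintype m]

/-- The state-optimality ("KKT", ground-state positivity) element
`Σ_ab G_ab • (B_a⋆ (h B_b - B_b h))` of a multiplier matrix `G` and a finite generator family `B`
— the dual image of the PSD constraint `[ω(B_a⋆ [h, B_b])]_{ab} ⪰ 0` (AKS eq. (state optimality),
second line, in matrix form). [cite: AraujoEtAl2023, §3.2 Prop. 11] -/
def kktForm (h : 𝓐) (G : Matrix m m ℂ) (B : m → 𝓐) : 𝓐 :=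
  ∑ i, ∑ j, G i j • (star (B i) * (h * B j - B j * h))

omit [StarModule ℂ 𝓐] in
/-- `ω` of the KKT element is the entrywise pairing of `G` with the block
`[ω(B_a⋆ (h B_b - B_b h))]_{ab}`. [cite: AraujoEtAl2023, §3.2 Prop. 11] -/
theorem map_kktForm (ω : 𝓐 →ₗ[ℂ] ℂ) (h : 𝓐) (G : Matrix m m ℂ) (B : m → 𝓐) :
    ω (kktForm h G B) = ∑ i, ∑ j, G i j * ω (star (B i) * (h * B j - B j * h)) := by
  simp [kktForm, map_sum, smul_eq_mul]

omit [StarModule ℂ 𝓐] in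
/-- Additivity of the KKT element in the multiplier (block-diagonal multipliers add up).
[cite: AraujoEtAl2023, §3.2 Prop. 11] -/
theorem kktForm_add (h : 𝓐) (G G' : Matrix m m ℂ) (B : m → 𝓐) :
    kktForm h (G + G') B = kktForm h G B + kktForm h G' B := by
  simp [kktForm, add_smul, Finset.sum_add_distrib]

omit [StarRing 𝓐] [StarModule ℂ 𝓐] in
/-- The commutator with a linear combination of generators:
`h (Σ wⱼ Bⱼ) - (Σ wⱼ Bⱼ) h = Σ wⱼ (h Bⱼ - Bⱼ h)`. [cite: AraujoEtAl2023, §3.2 Prop. 11] -/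
theorem mul_lincomb_sub_lincomb_mul (h : 𝓐) (w : m → ℂ) (B : m → 𝓐) :
    h * (∑ j, w j • B j) - (∑ j, w j • B j) * h = ∑ j, w j • (h * B j - B j * h) := by
  rw [Finset.mul_sum, Finset.sum_mul, ← Finset.sum_sub_distrib]
  exact Finset.sum_congr rfl fun j _ => by rw [mul_smul_comm, smul_mul_assoc, smul_sub]

/-- Expansion of `ω((Σᵢ vᵢBᵢ)⋆ (h (Σⱼ wⱼBⱼ) - (Σⱼ wⱼBⱼ) h))` in the block entries.
[cite: AraujoEtAl2023, §3.2 Prop. 11] -/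
theorem map_star_lincomb_mul_commutator_lincomb (ω : 𝓐 →ₗ[ℂ] ℂ) (h : 𝓐) (B : m → 𝓐)
    (v w : m → ℂ) :
    ω (star (∑ i, v i • B i) * (h * (∑ j, w j • B j) - (∑ j, w j • B j) * h)) =
      ∑ i, ∑ j, star (v i) * w j * ω (star (B i) * (h * B j - B j * h)) := by
  rw [mul_lincomb_sub_lincomb_mul, star_lincomb, Finset.sum_mul]
  simp_rw [Finset.mul_sum, smul_mul_smul_comm, map_sum, map_smul, smul_eq_mul]

/-- **Factorised multiplier**: if `G = L⋆ L` then
`ω(kktForm h G B) = Σ_k ω(C_k⋆ (h C_k - C_k h))` with `C_k = Σ_b L_kb B_b`.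
[cite: AraujoEtAl2023, §3.2 Prop. 11] -/
theorem map_kktForm_of_eq_star_mul (ω : 𝓐 →ₗ[ℂ] ℂ) (h : 𝓐) {G L : Matrix m m ℂ}
    (hL : G = star L * L) (B : m → 𝓐) :
    ω (kktForm h G B) =
      ∑ k, ω (star (∑ i, L k i • B i) * (h * (∑ j, L k j • B j) - (∑ j, L k j • B j) * h)) := by
  have hprod : ∀ i j : m, G i j = ∑ k, star (L k i) * L k j := by
    intro i j
    rw [hL, Matrix.star_eq_conjTranspose, Matrix.mul_apply]
    exact Finset.sum_congr rfl fun k _ => by rw [conjTranspose_apply]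
  simp_rw [map_star_lincomb_mul_commutator_lincomb, map_kktForm, hprod, Finset.sum_mul]
  exact (Finset.sum_congr rfl fun i _ => Finset.sum_comm).trans Finset.sum_comm

/-- **A PSD-weighted KKT element is nonnegative in every state obeying the ground-state
inequality on the span of the generators**: `G ⪰ 0` and
`Re ω(C⋆ (h C - C h)) ≥ 0` for every `C = Σ_b w_b B_b` give `0 ≤ Re ω(kktForm h G B)` — weak
duality for the state-optimality block ("perturbative positivity over `Span(P)`" of the defect
bootstrap). [cite: AraujoEtAl2023, §3.2 Prop. 11] [cite: ScheerEtAl2025, §II eq. (2)] -/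
theorem re_map_kktForm_nonneg [DecidableEq m] (ω : 𝓐 →ₗ[ℂ] ℂ) (h : 𝓐) {G : Matrix m m ℂ}
    (hG : G.PosSemidef) (B : m → 𝓐)
    (hstab : ∀ w : m → ℂ,
      0 ≤ (ω (star (∑ j, w j • B j) * (h * (∑ j, w j • B j) - (∑ j, w j • B j) * h))).re) :
    0 ≤ (ω (kktForm h G B)).re := by
  obtain ⟨L, hL⟩ := CStarAlgebra.nonneg_iff_eq_star_mul_self.mp hG.nonneg
  rw [map_kktForm_of_eq_star_mul ω h hL B, Complex.re_sum]
  exact Finset.sum_nonneg fun k _ => hstab _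

/-- The same in `ComplexOrder` (real AND nonnegative), when each one-generator expectation is.
[cite: AraujoEtAl2023, §3.2 Prop. 11] -/
theorem map_kktForm_nonneg [DecidableEq m] (ω : 𝓐 →ₗ[ℂ] ℂ) (h : 𝓐) {G : Matrix m m ℂ}
    (hG : G.PosSemidef) (B : m → 𝓐)
    (hstab : ∀ w : m → ℂ,
      0 ≤ ω (star (∑ j, w j • B j) * (h * (∑ j, w j • B j) - (∑ j, w j • B j) * h))) :
    0 ≤ ω (kktForm h G B) := by
  obtain ⟨L, hL⟩ := CStarAlgebra.nonneg_iff_eq_star_mul_self.mp hG.nonneg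
  rw [map_kktForm_of_eq_star_mul ω h hL B]
  exact Finset.sum_nonneg fun k _ => hstab _

end Abstract

/-! ### Matrix instances: sector ground states of a Hermitian matrix -/

section MatrixInstances

open Literature.MathematicalPhysics.QuantumLattice

variable {n : Type*} [Fintype n] [DecidableEq n]
variable {m : Type*} [Fintype m] [DecidableEq m]

omit [DecidableEq n] [DecidableEq m] in
/-- Sector-preserving generators have sector-preserving linear combinations. [folklore] -/
private theorem lincomb_mulVec_mem (K : Submodule ℂ (n → ℂ)) (B : m → Matrix n n ℂ)
    (hB : ∀ j, ∀ w ∈ K, B j *ᵥ w ∈ K) (c : m → ℂ) {w : n → ℂ} (hw : w ∈ K) :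
    (∑ j, c j • B j) *ᵥ w ∈ K := by
  rw [Matrix.sum_mulVec]
  exact K.sum_mem fun j _ => by rw [Matrix.smul_mulVec]; exact K.smul_mem _ (hB j w hw)

/-- The sector energy bounds the Rayleigh quotient of every vector of the sector:
`minEnergyOn A K · ‖w‖² ≤ Re ⟨w, A w⟩` for `w ∈ K` (scaling of `minEnergyOn_le_rayleigh_of_mem`).
[folklore] -/
private theorem minEnergyOn_mul_le_re_of_mem {A : Matrix n n ℂ} (hA : A.IsHermitian)
    (K : Submodule ℂ (n → ℂ)) {w : n → ℂ} (hw : w ∈ K) :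
    A.minEnergyOn K * (star w ⬝ᵥ w).re ≤ (star w ⬝ᵥ (A *ᵥ w)).re := by
  by_cases hw0 : w = 0
  · simp [hw0]
  obtain ⟨c, hc, h1⟩ := exists_smul_unit hw0
  have hle := minEnergyOn_le_rayleigh_of_mem hA K (K.smul_mem c hw) h1
  have hcc : (0 : ℝ) < (star c * c).re := by
    rw [Complex.star_def, Complex.conj_mul', ← Complex.ofReal_pow, Complex.ofReal_re]
    exact pow_pos (norm_pos_iff.2 hc) 2
  have him : (star c * c).im = 0 := by
    rw [Complex.star_def, Complex.conj_mul', ← Complex.ofReal_pow, Complex.ofReal_im]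
  have hsv : star (c • w) ⬝ᵥ (c • w) = (star c * c) * (star w ⬝ᵥ w) := by
    rw [star_smul, smul_dotProduct, dotProduct_smul, smul_smul, smul_eq_mul]
  have hsA : star (c • w) ⬝ᵥ (A *ᵥ (c • w)) = (star c * c) * (star w ⬝ᵥ (A *ᵥ w)) := by
    rw [mulVec_smul, star_smul, smul_dotProduct, dotProduct_smul, smul_smul, smul_eq_mul]
  rw [hsA, Complex.mul_re, him, zero_mul, sub_zero] at hle
  rw [hsv] at h1
  have h1' : (star w ⬝ᵥ w).re = ((star c * c).re)⁻¹ := by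
    have h := congrArg Complex.re h1
    rw [Complex.mul_re, him, zero_mul, sub_zero, Complex.one_re] at h
    exact eq_inv_of_mul_eq_one_right h
  rw [h1']
  have := mul_le_mul_of_nonneg_left hle (inv_nonneg.2 hcc.le)
  rw [← mul_assoc, inv_mul_cancel₀ hcc.ne', one_mul] at this
  linarith [this]

/-- **The ground-state inequality in a sector, one generator**: for Hermitian `A`, a sector `K`,
`C` mapping `K` into `K` and a sector ground state `ψ ∈ K`, `A ψ = E_K ψ`:
`0 ≤ Re ⟨ψ, Cᴴ (A C - C A) ψ⟩ = Re ⟨Cψ, (A - E_K) Cψ⟩` (Bratteli–Robinson II Prop. 5.3.19,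
`(1) ⇒ (2)`, finite-dimensional and sector-wise). [cite: BratteliRobinsonII1997, Prop. 5.3.19] -/
theorem re_expect_conjTranspose_mul_commutator_nonneg_of_sectorGS {A C : Matrix n n ℂ}
    (hA : A.IsHermitian) (K : Submodule ℂ (n → ℂ)) (hC : ∀ w ∈ K, C *ᵥ w ∈ K) {ψ : n → ℂ}
    (hψK : ψ ∈ K) (hAψ : A *ᵥ ψ = ((A.minEnergyOn K : ℝ) : ℂ) • ψ) :
    0 ≤ (star ψ ⬝ᵥ (Cᴴ * (A * C - C * A)) *ᵥ ψ).re := by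
  have hexp : star ψ ⬝ᵥ (Cᴴ * (A * C - C * A)) *ᵥ ψ =
      star (C *ᵥ ψ) ⬝ᵥ (A *ᵥ (C *ᵥ ψ)) -
        ((A.minEnergyOn K : ℝ) : ℂ) * (star (C *ᵥ ψ) ⬝ᵥ (C *ᵥ ψ)) := by
    rw [← mulVec_mulVec, sub_mulVec, ← mulVec_mulVec, ← mulVec_mulVec, hAψ, mulVec_smul,
      dotProduct_mulVec, ← star_mulVec, dotProduct_sub, dotProduct_smul, smul_eq_mul]
  have hE := minEnergyOn_mul_le_re_of_mem hA K (hC ψ hψK)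
  rw [hexp, Complex.sub_re, Complex.re_ofReal_mul]
  linarith

/-- **KKT block ⇒ nonnegative expectation in every sector ground state.** For Hermitian `A`, a
sector `K`, a multiplier `G ⪰ 0`, generators `B_b` mapping `K` into `K`, and a sector ground
state `ψ ∈ K`, `A ψ = E_K ψ` (`E_K = minEnergyOn A K`): `0 ≤ Re ⟨ψ, kktForm A G B ψ⟩`
(`= Σ_k Re ⟨C_kψ, (A - E_K) C_kψ⟩` with `C_k = Σ_b L_kb B_b`, `G = Lᴴ L`). Degenerate sector ground
levels allowed; `ψ` need not be normalised. [cite: BratteliRobinsonII1997, Prop. 5.3.19]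
[cite: FawziFawziScalet2024, §2] -/
theorem re_vectorState_kktForm_nonneg_of_sectorGS {A : Matrix n n ℂ} (hA : A.IsHermitian)
    (K : Submodule ℂ (n → ℂ)) {G : Matrix m m ℂ} (hG : G.PosSemidef) (B : m → Matrix n n ℂ)
    (hB : ∀ j, ∀ w ∈ K, B j *ᵥ w ∈ K) {ψ : n → ℂ} (hψK : ψ ∈ K)
    (hAψ : A *ᵥ ψ = ((A.minEnergyOn K : ℝ) : ℂ) • ψ) :
    0 ≤ (star ψ ⬝ᵥ kktForm A G B *ᵥ ψ).re := by
  have h := re_map_kktForm_nonneg (vectorState ψ) A hG B fun c => by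
    rw [vectorState_apply, Matrix.star_eq_conjTranspose]
    exact re_expect_conjTranspose_mul_commutator_nonneg_of_sectorGS hA K
      (fun w hw => lincomb_mulVec_mem K B hB c hw) hψK hAψ
  rwa [vectorState_apply] at h

/-- **Fock-space sectors.** On a fermionic Fock space, generators commuting with the particle
number `N̂` and with `S^z` preserve every joint sector `(N, S^z = M)`
(`mulVec_mem_szSector_of_commute`); hence for every ground state `ψ` of a Hermitian `H` IN that
sector and every `G ⪰ 0`: `0 ≤ Re ⟨ψ, kktForm H G B ψ⟩` — soundness of the state-optimality block
with `N`-, `S^z`-CONSERVING generators at ANY filling.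
[cite: FawziFawziScalet2024, §2] [cite: BratteliRobinsonII1997, Prop. 5.3.19] -/
theorem re_expect_kktForm_nonneg_of_isGroundStateInSector {Λ : Type*} [LinearOrder Λ] [Fintype Λ]
    {H : Matrix (Finset (Orb Λ)) (Finset (Orb Λ)) ℂ} (hH : H.IsHermitian) {N : ℕ} {M : ℝ}
    {G : Matrix m m ℂ} (hG : G.PosSemidef) (B : m → Matrix (Finset (Orb Λ)) (Finset (Orb Λ)) ℂ)
    (hBN : ∀ j, Commute (B j) totalNumber) (hBS : ∀ j, Commute (B j) HubbardWave0.spinZ)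
    {ψ : Fock (Orb Λ)} (hψ : IsGroundStateInSector H N M ψ) :
    0 ≤ (star ψ ⬝ᵥ kktForm H G B *ᵥ ψ).re :=
  re_vectorState_kktForm_nonneg_of_sectorGS hH (szSector N M) hG B
    (fun j _ hw => mulVec_mem_szSector_of_commute (hBN j) (hBS j) hw) hψ.1 hψ.2.2

end MatrixInstances

end Literature.MathematicalPhysics.QuantumManyBody.StateRelaxation
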